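import Summits.ResolutionOfSingularities.ResolutionOfSingularities.Theorems.HilbertSamuelEliminationSigmaMaxModificationsCorridor3WLadderSegmentsCut
import Summits.ResolutionOfSingularities.ResolutionOfSingularities.Theorems.HilbertSamuelEliminationSigmaMaxModificationsCorridor3WLadderUnitStart
import Summits.ResolutionOfSingularities.ResolutionOfSingularities.Theorems.HilbertSamuelEliminationSigmaMaxModificationsCorridor3ReachesCyclePackage
import Summits.ResolutionOfSingularities.ResolutionOfSingularities.Theorems.HilbertSamuelEliminationSigmaMaxModificationsMaxLocusClosed
import Summits.ResolutionOfSingularities.ResolutionOfSingularities.Theorems.HilbertSamuelEliminationSigmaMaxModificationsSemicontinuitySharp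
import Summits.ResolutionOfSingularities.ResolutionOfSingularities.Theorems.HilbertSamuelEliminationCampaignW42TertiaryReduction
import Summits.ResolutionOfSingularities.ResolutionOfSingularities.Theorems.HilbertSamuelEliminationCampaignW42TertiaryStates
import HarnessLib

/-!
# [OURS · L1 W4.2] ISOLATION IN THE HILBERT–SAMUEL LOCUS ⟺ ISOLATION IN THE STRATUM at good stages; the cut stages of a chain
# (crux `SigmaMaxModifications` stmt-ResolutionOfSingularities-18506; conjunct `SigmaMaxModificationsCorridor3` stmt-…-19249; line
# `w_ladder` v6; plan-1 RULINGS v3.10-1 (A) «U-seg = segment extraction», object `Moving.UnitTowerExtractionLocAtQM`)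

Stub worker res-L1-w42-stub-1 (gen 3). Helper file `--supports stmt-ResolutionOfSingularities-19249 --as helper`; kernel only, no named
fact (universe `0`, where the tree's semicontinuity theorems over a field live).

* `Moving.Seg.iso_of_stratumIsolated` — at a stage carrying the cycle invariant (finite type over a field, `dim ≤ N`, `ν` never exceeded), a
  marked point of `X_n(ν)` ISOLATED IN ITS `ν`-STRATUM is isolated in the Hilbert–Samuel locus `(X_n)_max` (`Moving.Iso`): `Σ_{X_n}` is
  finite (`Scheme.finite_hsValues_of_isExcellent`) and the loci `X_n(≥ μ)` are closed (`stub_isClosed_hsMaxLocus_over_field`), so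
  `U ∖ ⋃_{μ ≰ ν} X_n(≥ μ)` is an open meeting `(X_n)_max` in the marked point only. With `CampaignW42.stratumIsolated_of_iso` (the converse
  at good stages) this makes `Moving.Iso` STABLE ALONG WAITING STEPS (cf. `…WLadderUnitStart`).
* `Moving.Seg.hsFun_le_of_specializes_of_cycleInv` — upper semicontinuity of `H` along generizations at such a stage
  (`stub_hsFun_le_of_specializes_over_field`).
* `Moving.Seg.exists_isBlownUp_and_iso` — **along a chain from a maximal origin that is blown up infinitely often and isolated infinitely
  often, BLOWN-UP ISOLATED stages occur infinitely often** (the cut stages of the units-half extraction: from an isolated stage, isolation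
  survives the waiting steps up to the next genuine one).

OURS bookkeeping; NOT a statement of the manuscript [Hironaka2017] nor of [CossartJannsenSaito2020]. AI-written; AI review is weaker than
expert review.

References: V. Cossart, U. Jannsen, S. Saito, LNM 2270 (2020), Def. 13.3, Thm. 2.33, Lemma 2.36 [CossartJannsenSaito2020].
-/

noncomputable section

set_option linter.dupNamespace false -- namespace `…Corridor3.Moving` re-enters `…Corridor3` (module convention of the Moving files)

open CategoryTheory AlgebraicGeometry TopologicalSpace Topology
open Literature.AlgebraicGeometry.Resolution Literature.RingTheory.HilbertSamuel
open Literature.AlgebraicGeometry.CossartJannsenSaito2020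
open Summit.ResolutionOfSingularities.ResolutionOfSingularities.Theorems.CampaignW42
open Summit.ResolutionOfSingularities.ResolutionOfSingularities.Theorems.SigmaMaxModificationsCorridor3.Helpers
open Summit.ResolutionOfSingularities.ResolutionOfSingularities.Theorems.SigmaMaxModifications.Sketch

namespace Summit.ResolutionOfSingularities.ResolutionOfSingularities.Theorems.SigmaMaxModificationsCorridor3.Moving.Seg

variable {R : ∀ S : Scheme.{0}, CentreSeq S → Prop} {N : ℕ} {ν : ℕ → ℕ} {k : Type} [Field k]

/-! ## §1. Stratum-isolation ⇒ isolation in the Hilbert–Samuel locus -/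

/-- **ISOLATED IN THE `ν`-STRATUM ⇒ ISOLATED IN THE HILBERT–SAMUEL LOCUS** at a stage carrying the cycle invariant: the other values
`μ ≰ ν` of the (finite) `Σ_{X_n}` have closed loci `X_n(≥ μ)` missing the marked point; off their union, a point of `(X_n)_max` near the
marked point has the maximal value `ν`. [cite: CossartJannsenSaito2020, Def. 13.3, Thm. 2.33, Lemma 2.36] -/
theorem iso_of_stratumIsolated {s : MarkedStage.{0}} (h : Helpers.CycleInv k N ν s) (hpt : s.pt ∈ Scheme.hsStratum s.W N ν)
    (hU : ∃ U : Set s.W, IsOpen U ∧ s.pt ∈ U ∧ U ∩ Scheme.hsStratum s.W N ν ⊆ {s.pt}) : Iso N s := by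
  obtain ⟨⟨f, hft, hqc⟩, -, hdim, hsup, -, -⟩ := h
  haveI : IsLocallyNoetherian s.W := s.ln
  haveI := hft
  haveI := hqc
  haveI : IsNoetherian s.W := Scheme.isNoetherian_of_finiteType_over_field f
  have husc : ∀ μ : ℕ → ℕ, IsClosed (Scheme.hsStratumGE s.W N μ) :=
    (stub_isClosed_hsMaxLocus_over_field stub_hsFun_le_of_specializes_over_field k s.W f hft hqc N hdim).1
  have hexc : Scheme.IsExcellent s.W := Scheme.isExcellent_of_locallyOfFiniteType Stacks07QW_field_holds f
  have hfin : (Scheme.hsValues s.W N).Finite := Scheme.finite_hsValues_of_isExcellent hexc N (hsPsi_le_of_dim_le' hdim)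
  obtain ⟨U, hUo, hptU, hUiso⟩ := hU
  have hνpt : Scheme.hsFun s.W N s.pt = ν := Scheme.mem_hsStratum_iff.mp hpt
  -- the finitely many values not below `ν`, and the open `V`
  let S : Set (ℕ → ℕ) := {μ | μ ∈ Scheme.hsValues s.W N ∧ ¬ μ ≤ ν}
  have hSfin : S.Finite := hfin.subset fun μ hμ => hμ.1
  refine ⟨U ∩ ⋂ μ ∈ S, (Scheme.hsStratumGE s.W N μ)ᶜ, hUo.inter (hSfin.isOpen_biInter fun μ _ => (husc μ).isOpen_compl), ?_⟩
  ext w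
  simp only [Set.mem_inter_iff, Set.mem_singleton_iff]
  constructor
  · rintro ⟨⟨hwU, hwI⟩, hwmax⟩
    rw [Scheme.mem_hsMaxLocus_iff] at hwmax
    by_cases hle : Scheme.hsFun s.W N w ≤ ν
    · have heq : Scheme.hsFun s.W N w = ν := le_antisymm hle (hwmax.2 ⟨s.pt, hνpt⟩ hle)
      exact hUiso ⟨hwU, Scheme.mem_hsStratum_iff.mpr heq⟩
    · exfalso
      have hS : Scheme.hsFun s.W N w ∈ S := ⟨⟨w, rfl⟩, hle⟩
      exact (Set.mem_iInter₂.mp hwI _ hS) (Scheme.hsStratum_subset_hsStratumGE N _ (Scheme.mem_hsStratum_hsFun N w))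
  · intro hw
    rw [hw]
    refine ⟨⟨hptU, Set.mem_iInter₂.mpr fun μ hμ hptμ => hμ.2 ?_⟩, Scheme.mem_hsMaxLocus_iff.mpr ?_⟩
    · rw [Scheme.mem_hsStratumGE_iff, hνpt] at hptμ
      exact hptμ
    · rw [hνpt]
      exact ⟨⟨s.pt, hνpt⟩, fun μ ⟨w', hw'⟩ hle => by subst hw'; exact (hsup w' hle).le⟩

/-- Upper semicontinuity of `H` along generizations at a stage carrying the cycle invariant (`dim ≤ N` bounds `ψ`).
[cite: CossartJannsenSaito2020, Thm. 2.33 (1)] -/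
theorem hsFun_le_of_specializes_of_cycleInv {s : MarkedStage.{0}} (h : Helpers.CycleInv k N ν s) {w y : s.W} (hy : y ⤳ w) :
    Scheme.hsFun s.W N y ≤ Scheme.hsFun s.W N w := by
  obtain ⟨⟨f, hft, -⟩, -, hdim, -⟩ := h
  haveI : IsLocallyNoetherian s.W := s.ln
  exact stub_hsFun_le_of_specializes_over_field k s.W f hft N w y hy (hsPsi_le_of_dim_le' hdim w)

/-! ## §2. Blown-up isolated stages occur infinitely often -/

/-- **THE CUT STAGES EXIST**: along a chain of canonical near steps from a maximal origin (admissible oracle, `ν ≠ Φ^{(N)}`) that is blown up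
infinitely often and whose marked point is isolated in the Hilbert–Samuel locus infinitely often, there are infinitely many stages that are
BOTH blown up and isolated — from an isolated stage `w`, isolation in the stratum survives the waiting steps up to the next blown-up stage
(`…WLadderUnitStart`), where it is isolation in the Hilbert–Samuel locus again (`iso_of_stratumIsolated`). [cite: CossartJannsenSaito2020, Def. 13.3, Def. 6.38] -/
theorem exists_isBlownUp_and_iso (hRa : OracleAdmissible R) (hν : ν ≠ iterPSum N Phi) {p : ℕ} {X : Scheme.{0}} [IsLocallyNoetherian X]
    {x : X} (hX : IsMaximalOrigin p N ν X x) {c : ℕ → MarkedStage.{0}} (h0 : Reaches R N ν (MarkedStage.init X x) (c 0))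
    (hc : ∀ n, CanonicalNearStep R N ν (c n) (c (n + 1))) (hgen : ∀ n, ∃ m, n ≤ m ∧ (c m).IsBlownUp R N ν)
    (hIso : ∀ n, ∃ m, n ≤ m ∧ Iso N (c m)) : ∀ n, ∃ m, n ≤ m ∧ (c m).IsBlownUp R N ν ∧ Iso N (c m) := by
  intro n
  obtain ⟨w, hnw, hisoW⟩ := hIso n
  obtain ⟨k', _, _, hg⟩ := hX.exists_stateGood_of_reaches hRa hν (reaches_chain h0 hc w)
  have hUw := stratumIsolated_of_iso hg hisoW
  have hUm := stratumIsolated_of_chain_of_forall_not_isBlownUp hc (Seg.le_nextB hgen w)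
    (fun j hwj hjm => Seg.not_B_of_lt_nextB hgen hwj hjm) hUw
  obtain ⟨k'', _, hcyc⟩ := Helpers.CycleInv.init (N := N) (ν := ν) hX
  exact ⟨Seg.nextB hgen w, hnw.trans (Seg.le_nextB hgen w), Seg.B_nextB hgen w,
    iso_of_stratumIsolated (hcyc.of_reaches hRa hν (reaches_chain h0 hc _))
      (pt_mem_hsStratum_of_reaches hX.mem_stratum (reaches_chain h0 hc _)) hUm⟩

end Summit.ResolutionOfSingularities.ResolutionOfSingularities.Theorems.SigmaMaxModificationsCorridor3.Moving.Seg

end
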